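import Mathlib
import Literature.NumberTheory.Transcendental.SemialgebraicMapsProofs
import Summits.KontsevichZagierPeriods.KontsevichZagierPeriods.Theorems.ScissorsTransportPolytopeTransportCells

/-!
# Polytope transport — transports onto boxes; cells are transportable

Helper file for `PolytopeTransport` (stmt-KontsevichZagierPeriods-10815, route ScissorsTransport).
A *transport* of a set `A ⊆ ℝⁿ⁺¹` onto the open box `box n V = (0, V) × (0, 1)ⁿ` (`Transport A V`,
`V ∈ ℚ`) is the data needed on both sides of ONE Kontsevich–Zagier change of variables with
Jacobian `±1`: a `ℚ`-semialgebraic map `Ψ` with a `ℚ`-semialgebraic inverse on `Ψ '' A`, both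
differentiable within their domains with `|det| = 1`, and `Ψ '' A ⊆ box n V` of full measure. We
prove the inverse-function package used to invert strictly differentiable injective maps on open
sets (Mathlib's `HasStrictFDerivAt.to_local_left_inverse`), that the inverse of a semialgebraic map
is semialgebraic (graph swap), and that every well-formed cell (`CellData`, `exists_cellMap` with
weight `1`, rescaled in the first coordinate by its rational volume `TW c 1`) admits a transport
onto its box — with image exactly the box. Folklore.
-/

noncomputable section

open Set MvPolynomial MeasureTheory
open Literature.NumberTheory.Transcendental
open Literature.NumberTheory.Transcendental.KZ (unitCube mem_unitCube isOpen_unitCube)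
open Literature.ModelTheory.ExponentialFields (IsSemialgebraic isSemialgebraic_univ)

namespace Summit.KontsevichZagierPeriods.ScissorsTransport.PolytopeTransport

variable {n : ℕ}

/-! ### Inverse functions of strictly differentiable injective maps on open sets -/

section IFT

variable {E : Type*} [NormedAddCommGroup E] [NormedSpace ℝ E] [CompleteSpace E]

/-- The image of an open set under a map with invertible strict derivatives is open. [folklore] -/
theorem isOpen_image_of_hasStrictFDerivAt {U : Set E} (hU : IsOpen U) {f : E → E}
    {f' : E → E ≃L[ℝ] E} (hf : ∀ x ∈ U, HasStrictFDerivAt f (f' x : E →L[ℝ] E) x) :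
    IsOpen (f '' U) := by
  rw [isOpen_iff_mem_nhds]
  rintro _ ⟨x, hx, rfl⟩
  rw [← (hf x hx).map_nhds_eq_of_equiv]
  exact Filter.image_mem_map (hU.mem_nhds hx)

/-- The inverse (`Function.invFunOn`) of an injective map with invertible strict derivatives on an
open set is strictly differentiable at image points, with the inverse derivative (inverse function
theorem). [folklore] -/
theorem hasStrictFDerivAt_invFunOn {U : Set E} (hU : IsOpen U) {f : E → E} {f' : E → E ≃L[ℝ] E}
    (hf : ∀ x ∈ U, HasStrictFDerivAt f (f' x : E →L[ℝ] E) x) (hinj : InjOn f U) {x : E}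
    (hx : x ∈ U) :
    HasStrictFDerivAt (Function.invFunOn f U) ((f' x).symm : E →L[ℝ] E) (f x) := by
  refine (hf x hx).to_local_left_inverse ?_
  filter_upwards [hU.mem_nhds hx] with y hy
  exact hinj.leftInvOn_invFunOn hy

end IFT

/-- The determinant of a composite of continuous linear maps. [folklore] -/
theorem det_comp {E : Type*} [AddCommGroup E] [Module ℝ E] [TopologicalSpace E]
    (f g : E →L[ℝ] E) : (f.comp g).det = f.det * g.det :=
  LinearMap.det_comp (f : E →ₗ[ℝ] E) (g : E →ₗ[ℝ] E)

/-! ### Inverses of semialgebraic maps -/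

/-- A left inverse of a `ℚ`-semialgebraic map is `ℚ`-semialgebraic on the image (swap the two
blocks of coordinates of the graph). [folklore] -/
theorem isSemialgebraicMapOn_leftInverse {m : ℕ} {s : Set (Fin m → ℝ)}
    {f g : (Fin m → ℝ) → (Fin m → ℝ)} (hf : IsSemialgebraicMapOn ℚ s f)
    (hgf : ∀ x ∈ s, g (f x) = x) : IsSemialgebraicMapOn ℚ (f '' s) g := by
  unfold IsSemialgebraicMapOn at hf ⊢
  let σ : Fin (m + m) → Fin (m + m) :=
    Fin.append (fun i : Fin m => Fin.natAdd m i) (fun j : Fin m => Fin.castAdd m j)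
  have hσ₁ : ∀ i : Fin m, σ (Fin.castAdd m i) = Fin.natAdd m i := fun i => Fin.append_left _ _ i
  have hσ₂ : ∀ j : Fin m, σ (Fin.natAdd m j) = Fin.castAdd m j := fun j => Fin.append_right _ _ j
  convert hf.preimage_comp σ using 1
  ext z
  simp only [mem_setOf_eq, mem_preimage, mem_image]
  constructor
  · rintro ⟨_, ⟨x, hx, rfl⟩, rfl⟩
    refine ⟨x, hx, ?_⟩
    ext k
    refine Fin.addCases (fun i => ?_) (fun j => ?_) k
    · rw [Function.comp_apply, hσ₁, Fin.append_right, Fin.append_left, hgf x hx]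
    · rw [Function.comp_apply, hσ₂, Fin.append_left, Fin.append_right]
  · rintro ⟨x, hx, hz⟩
    refine ⟨f x, ⟨x, hx, rfl⟩, ?_⟩
    rw [hgf x hx]
    ext k
    refine Fin.addCases (fun i => ?_) (fun j => ?_) k
    · have h := congrFun hz (Fin.natAdd m i)
      rw [Function.comp_apply, hσ₂, Fin.append_right] at h
      rw [Fin.append_left, h]
    · have h := congrFun hz (Fin.castAdd m j)
      rw [Function.comp_apply, hσ₁, Fin.append_left] at h
      rw [Fin.append_right, h]

/-! ### Boxes and transports -/

/-- The open box `(0, V) × (0, 1)ⁿ ⊆ ℝⁿ⁺¹` (first coordinate of length `V`). [folklore] -/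
def box (n : ℕ) (V : ℝ) : Set (Fin (n + 1) → ℝ) := {y | y 0 ∈ Ioo 0 V ∧ Fin.tail y ∈ unitCube n}

/-- The box as a product of intervals. [folklore] -/
theorem box_eq_pi (n : ℕ) (V : ℝ) :
    box n V = Set.pi univ (Fin.cons (Ioo 0 V) (fun _ : Fin n => Ioo (0 : ℝ) 1)) := by
  ext y
  simp only [box, mem_unitCube, mem_setOf_eq, mem_pi, mem_univ, true_imp_iff, Fin.forall_fin_succ,
    Fin.cons_zero, Fin.cons_succ]
  rfl

/-- Boxes are open. [folklore] -/
theorem isOpen_box (n : ℕ) (V : ℝ) : IsOpen (box n V) := by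
  rw [box_eq_pi]
  refine isOpen_set_pi finite_univ fun i _ => ?_
  refine Fin.cases ?_ (fun j => ?_) i
  · simpa using isOpen_Ioo
  · simpa using isOpen_Ioo

/-- The volume of a box is the length of its first side. [folklore] -/
theorem volume_box (n : ℕ) (V : ℝ) : volume (box n V) = ENNReal.ofReal V := by
  rw [box_eq_pi, volume_pi_pi, Fin.prod_univ_succ]
  simp [Real.volume_Ioo]

/-- A *transport* of `A ⊆ ℝⁿ⁺¹` onto the box of rational length `V`: a `ℚ`-semialgebraic map with
`ℚ`-semialgebraic inverse on the image, both differentiable within their domains with Jacobian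
`±1`, the image being a full-measure subset of `box n V`. [folklore] -/
structure Transport (A : Set (Fin (n + 1) → ℝ)) (V : ℚ) where
  /-- the forward map -/
  toFun : (Fin (n + 1) → ℝ) → (Fin (n + 1) → ℝ)
  /-- the inverse map (on the image) -/
  invFun : (Fin (n + 1) → ℝ) → (Fin (n + 1) → ℝ)
  /-- derivative of the forward map -/
  deriv : (Fin (n + 1) → ℝ) → (Fin (n + 1) → ℝ) →L[ℝ] (Fin (n + 1) → ℝ)
  /-- derivative of the inverse map -/
  derivInv : (Fin (n + 1) → ℝ) → (Fin (n + 1) → ℝ) →L[ℝ] (Fin (n + 1) → ℝ)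
  /-- the source is `ℚ`-semialgebraic -/
  sa_set : IsSemialgebraic ℚ A
  /-- the forward map is `ℚ`-semialgebraic on the source -/
  sa : IsSemialgebraicMapOn ℚ A toFun
  /-- the inverse map is `ℚ`-semialgebraic on the image -/
  sa_inv : IsSemialgebraicMapOn ℚ (toFun '' A) invFun
  /-- the forward map is differentiable within the source -/
  hasFDerivWithinAt : ∀ x ∈ A, HasFDerivWithinAt toFun (deriv x) A x
  /-- the inverse map is differentiable within the image -/
  hasFDerivWithinAt_inv : ∀ y ∈ toFun '' A, HasFDerivWithinAt invFun (derivInv y) (toFun '' A) y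
  /-- Jacobian `±1` -/
  abs_det : ∀ x ∈ A, |(deriv x).det| = 1
  /-- Jacobian `±1` of the inverse -/
  abs_det_inv : ∀ y ∈ toFun '' A, |(derivInv y).det| = 1
  /-- `invFun` is a left inverse on the source -/
  left_inv : ∀ x ∈ A, invFun (toFun x) = x
  /-- the image lies in the box -/
  image_subset : toFun '' A ⊆ box n V
  /-- the image has full measure in the box -/
  null : volume (box n (V : ℝ) \ toFun '' A) = 0

/-! ### Cells are transportable -/

/-- Scaling of the first coordinate by `V`, as a continuous linear map. [folklore] -/
def scaleCLM (n : ℕ) (V : ℝ) : (Fin (n + 1) → ℝ) →L[ℝ] (Fin (n + 1) → ℝ) :=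
  consCLM (V • ContinuousLinearMap.proj (R := ℝ) (φ := fun _ : Fin (n + 1) => ℝ) 0)
    (ContinuousLinearMap.id ℝ _)

/-- `scaleCLM n V` multiplies the first coordinate by `V`. [folklore] -/
@[simp] theorem scaleCLM_apply (V : ℝ) (h : Fin (n + 1) → ℝ) :
    scaleCLM n V h = Fin.cons (V * h 0) (Fin.tail h) := by
  simp [scaleCLM]

/-- `det (scaleCLM n V) = V`. [folklore] -/
theorem det_scaleCLM (V : ℝ) : (scaleCLM n V).det = V := by
  rw [scaleCLM, det_consCLM]
  simp [show ((ContinuousLinearMap.id ℝ (Fin n → ℝ)).det = 1) from LinearMap.det_id]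

/-- Scaling by `V > 0` carries the unit cube onto the box of length `V`. [folklore] -/
theorem scaleCLM_image_unitCube {V : ℝ} (hV : 0 < V) : scaleCLM n V '' unitCube (n + 1) = box n V := by
  apply Subset.antisymm
  · rintro _ ⟨x, hx, rfl⟩
    rw [mem_unitCube_succ] at hx
    refine ⟨?_, ?_⟩
    · simp only [scaleCLM_apply, Fin.cons_zero]
      exact ⟨mul_pos hV hx.1.1, by nlinarith [hx.1.2]⟩
    · simpa using hx.2
  · intro y hy
    refine ⟨Fin.cons (y 0 / V) (Fin.tail y), ?_, ?_⟩
    · rw [cons_mem_unitCube]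
      exact ⟨⟨div_pos hy.1.1 hV, (div_lt_one hV).2 hy.1.2⟩, hy.2⟩
    · rw [scaleCLM_apply, Fin.cons_zero, Fin.tail_cons, mul_div_cancel₀ _ hV.ne', Fin.cons_self_tail]

/-- The scaling map is `ℚ`-semialgebraic when `V` is rational. [folklore] -/
theorem isSemialgebraicMapOn_scaleCLM (V : ℚ) :
    IsSemialgebraicMapOn ℚ (univ : Set (Fin (n + 1) → ℝ)) (scaleCLM n (V : ℝ)) := by
  convert isSemialgebraicMapOn_aeval (isSemialgebraic_univ (ι := Fin (n + 1)) (R := ℝ))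
    (Fin.cons (C V * X 0) (fun j : Fin n => (X j.succ : MvPolynomial (Fin (n + 1)) ℚ))) using 2 with x
  ext i
  refine Fin.cases ?_ (fun j => ?_) i
  · simp
  · simp [Fin.tail]

open CellData in
/-- **Every well-formed cell is transportable** onto the box of length its (rational) volume
`TW c 1`, with image exactly the box. [folklore] -/
theorem exists_transport_cell (c : CellData (n + 1)) (hc : c ∈ CellData.wfSet (n + 1)) :
    ∃ T : Transport c.set (c.TW 1), T.toFun '' c.set = box n ((c.TW 1 : ℚ) : ℝ) := by
  classical
  have hw1 : ∀ x ∈ c.set, 0 < aeval x (1 : MvPolynomial (Fin (n + 1)) ℚ) := fun x _ => by simp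
  obtain ⟨G, D, hsa, hder, hdet, hinj, himg⟩ := exists_cellMap c hc 1 hw1
  set V : ℝ := ((c.TW 1 : ℚ) : ℝ) with hV_def
  have hV : 0 < V := TW_pos c hc 1 hw1
  have hU : IsOpen c.set := isOpen_set c
  set Ψ : (Fin (n + 1) → ℝ) → (Fin (n + 1) → ℝ) := fun x => scaleCLM n V (G x) with hΨ_def
  set DΨ : (Fin (n + 1) → ℝ) → (Fin (n + 1) → ℝ) →L[ℝ] (Fin (n + 1) → ℝ) :=
    fun x => (scaleCLM n V).comp (D x) with hDΨ_def
  have hderΨ : ∀ x ∈ c.set, HasStrictFDerivAt Ψ (DΨ x) x := fun x hx =>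
    (scaleCLM n V).hasStrictFDerivAt.comp x (hder x hx)
  have hdetΨ : ∀ x ∈ c.set, (DΨ x).det = 1 := by
    intro x hx
    rw [hDΨ_def, det_comp, det_scaleCLM, hdet x hx, map_one, mul_one_div_cancel hV.ne']
  have hne : ∀ x ∈ c.set, (DΨ x).det ≠ 0 := fun x hx => by rw [hdetΨ x hx]; exact one_ne_zero
  -- invertible derivatives as equivalences (junk value `1` off the cell)
  set Eq' : (Fin (n + 1) → ℝ) → (Fin (n + 1) → ℝ) ≃L[ℝ] (Fin (n + 1) → ℝ) := fun x =>
    if hx : x ∈ c.set then (DΨ x).toContinuousLinearEquivOfDetNeZero (hne x hx)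
    else ContinuousLinearEquiv.refl ℝ _ with hEq'_def
  have hEq' : ∀ x ∈ c.set, (Eq' x : (Fin (n + 1) → ℝ) →L[ℝ] (Fin (n + 1) → ℝ)) = DΨ x := by
    intro x hx
    rw [hEq'_def]
    simp [dif_pos hx]
  have hderΨ' : ∀ x ∈ c.set, HasStrictFDerivAt Ψ (Eq' x : (Fin (n + 1) → ℝ) →L[ℝ] _) x :=
    fun x hx => by rw [hEq' x hx]; exact hderΨ x hx
  have hinjΨ : InjOn Ψ c.set := by
    intro x₁ h₁ x₂ h₂ h
    refine hinj h₁ h₂ ?_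
    have hS : Function.Injective (scaleCLM n V) := by
      intro a b hab
      have h0 := congrFun hab 0
      have ht := congrArg Fin.tail hab
      simp only [scaleCLM_apply, Fin.cons_zero, Fin.tail_cons] at h0 ht
      rw [← Fin.cons_self_tail a, ← Fin.cons_self_tail b, mul_left_cancel₀ hV.ne' h0, ht]
    exact hS h
  set Ψi := Function.invFunOn Ψ c.set with hΨi_def
  have hleft : ∀ x ∈ c.set, Ψi (Ψ x) = x := fun x hx => hinjΨ.leftInvOn_invFunOn hx
  have himgΨ : Ψ '' c.set = box n V := by
    rw [hΨ_def, ← image_image, himg, scaleCLM_image_unitCube hV]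
  refine ⟨⟨Ψ, Ψi, DΨ, fun y => ((Eq' (Ψi y)).symm : (Fin (n + 1) → ℝ) →L[ℝ] (Fin (n + 1) → ℝ)),
    isSemialgebraic_set c, ?_, ?_, ?_, ?_, ?_, ?_, hleft, himgΨ.le, ?_⟩, himgΨ⟩
  · exact IsSemialgebraicMapOn.comp_holds (isSemialgebraicMapOn_scaleCLM (c.TW 1)) hsa
      (mapsTo_univ _ _)
  · exact isSemialgebraicMapOn_leftInverse
      (IsSemialgebraicMapOn.comp_holds (isSemialgebraicMapOn_scaleCLM (c.TW 1)) hsa (mapsTo_univ _ _))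
      hleft
  · exact fun x hx => (hderΨ x hx).hasFDerivAt.hasFDerivWithinAt
  · rintro _ ⟨x, hx, rfl⟩
    rw [hleft x hx]
    exact (hasStrictFDerivAt_invFunOn hU hderΨ' hinjΨ hx).hasFDerivAt.hasFDerivWithinAt
  · intro x hx
    rw [hdetΨ x hx, abs_one]
  · rintro _ ⟨x, hx, rfl⟩
    rw [hleft x hx, ContinuousLinearEquiv.det_coe_symm, hEq' x hx, hdetΨ x hx]
    simp
  · rw [himgΨ, ← hV_def]
    simp

end Summit.KontsevichZagierPeriods.ScissorsTransport.PolytopeTransport
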